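import Literature.Algebra.Polynomial.RootProductsResultant
import Literature.NumberTheory.LFunctions.WeilFactorizationOfPointCountFormula
import Literature.AlgebraicGeometry.Motives.AbelianVarietyPointCountIsogenyInvariance
import Literature.NumberTheory.LFunctions.WeilConjecturesDeligneReductionProofs
import HarnessLib

/-!
# The Weil conjectures pass to products: Weil factorisations of `Z(V, T)` and `Z(W, T)` give one of
# `Z(V ×ₖ W, T)` in dimension `dim V + dim W`, `P_κ(V × W) = ∏_{i+j=κ} P_i(V) ⊙ P_j(W)`
# (`Z(X × Y, t) = Z(X, t) ∗ Z(Y, t)` in the Witt ring `W(ℤ)`)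

Topic `Literature/NumberTheory/LFunctions`; THEOREMS ONLY (no definition, no instance, no named fact;
D-0026).  Assembles `Algebra/Polynomial/RootProductsResultant` (the composed multiplication
`P ⊙ Q = ∏ᵢ∏ⱼ (1 − αᵢβⱼT) ∈ ℤ[T]` as a resultant, row g45-#1) and
`LFunctions/WeilFactorizationOfPointCountFormula` (the point-count formula forces the rationality identity,
row g45-#2) with `#(V ×ₖ W)(𝔽_{q^m}) = #V(𝔽_{q^m}) · #W(𝔽_{q^m})` (tree `pointCount_tensorObj`).  No cohomology
theory, no Künneth axiom, and NO hypothesis on `V ×ₖ W`: the Riemann hypothesis for the product is PROVED from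
that of the factors (weights add under `⊙`).  Compare `Motives/PointCountsKunnethBettiNumbers` /
`PointCountsKunnethReciprocalRoots` (rows g44-#3/#5/#8), which ASSUMED a Weil factorisation of `Z(V ×ₖ W)` and
read off its degrees and roots; here its EXISTENCE.

## Sources, verbatim

N. Ramachandran, *Zeta functions, Grothendieck groups, and the Witt ring*, Bull. Sci. Math. 139 (2015)
[Ramachandran2014], Theorem 2.1: «Let `X` and `Y` be schemes of finite type over `Spec k = 𝔽_q`. (i) The zeta
function of the product `X × Y` is the Witt product of the zeta functions of `X` and `Y`:
`Z(X × Y, t) = Z(X, t) ∗ Z(Y, t) ∈ W(ℤ)`.  In particular, `Z(Xⁿ, t) = Z(X,t) ∗ ⋯ ∗ Z(X,t)` (`n` factors)»;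
proof: «the ghost map `gh : W(ℤ) → ℤ^ℕ` is an injective ring homomorphism … `#X(𝔽_{qⁿ})` is the `n`'th ghost
component of `Z(X,t)`.  Now (i) follows from the identity `#(X × Y)(𝔽_{qⁿ}) = #X(𝔽_{qⁿ}) · #Y(𝔽_{qⁿ})`»;
second proof: «We can write `Z(X,t)` in `W(ℚ̄_ℓ)` as a sum `Σ [α_X]` over the (inverse) eigenvalues `α_X` of
Frobenius of `X`.  By the Künneth theorem, any `α_{X×Y}` is a product of a `α_X` and a `α_Y`»; §1:
«`gh([a][b]) = gh([a]) · gh([b])`», `[a] = (1 − at)⁻¹`.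
R. Hartshorne, *Algebraic Geometry* [Hartshorne1977], II Thm. 3.3 (`(X ×ₖ Y)(L) = X(L) × Y(L)`), App. C
Th. 1.1–1.3 (the Weil conjectures) and (1.3) «`Pᵢ(t) = ∏ (1 − α_{ij} t)` … `|α_{ij}| = q^{i/2}`».
P. Deligne, *La conjecture de Weil. I* [Deligne1974], (1.5.4), Th. (1.6).

## What is here

For a finite field `k` (`q = #k`), `k`-schemes `V`, `W` and Weil factorisations `(PVᵢ)_{i ≤ 2n}` of `Z(V, T)`,
`(PWⱼ)_{j ≤ 2n'}` of `Z(W, T)`: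
* §1 the composed multiplication on the Weil data: `(1 − T) ⊙ (1 − T) = 1 − T`,
  `(1 − aT) ⊙ (1 − bT) = 1 − abT` (`composedMul_one_sub_X`, `composedMul_one_sub_C_mul_X`); power sums and roots
  of finite products of polynomials.
* §2 **`IsWeilFactorization.exists_tensor`**: `Z(V ×ₖ W, T)` HAS a Weil factorisation `(P_κ)_{κ ≤ 2(n+n')}` in
  dimension `n + n'`, namely `P_κ = ∏_{i + j = κ} PVᵢ ⊙ PWⱼ`: `P_κ(0) = 1`, `P₀ = 1 − T`, `P_{2(n+n')} = 1 − q^{n+n'}T`,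
  every complex root of `P_κ` has absolute value `q^{−κ/2}` (`|αᵢβⱼ| = q^{(i+j)/2}`), and
  `Z(V ×ₖ W) ∏_{κ even} P_κ = ∏_{κ odd} P_κ` because both sides have the ghost components
  `#V(𝔽_{q^m}) #W(𝔽_{q^m}) = Σ_{i,j} (−1)^{i+j} Σ (αᵢβⱼ)^m`; the theorem also records `deg P_κ = Σ_{i+j=κ} bᵢ(V) bⱼ(W)`
  and the multiset of complex roots of `P_κ` (pairwise products).  Corollaries:
  **`IsWeilFactorization.tensor_roots_eq_sum`** (by uniqueness of Weil factorisations, ANY Weil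
  factorisation of `Z(V ×ₖ W)` in dimension `n + n'` is this one) and
  **`exists_isWeilFactorization_tensor`** (the property «`Z(X, T)` admits a Weil factorisation in dimension
  `dim X`» is closed under products — the Weil conjectures for `X × Y` from those for `X` and `Y`, as for
  products of curves and abelian varieties before Deligne).

HC is not touched.

## References

* [Ramachandran2014] N. Ramachandran, *Zeta functions, Grothendieck groups, and the Witt ring*, Bull. Sci.
  Math. 139 (2015) 599–627 (arXiv:1407.1813), Theorem 2.1 (i) with both proofs, Lemma 2.3, §1.
* [Hartshorne1977] R. Hartshorne, *Algebraic Geometry*, II Thm. 3.3; App. C, Th. 1.1–1.3, (1.3).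
* [Deligne1974] P. Deligne, *La conjecture de Weil. I*, Publ. Math. IHÉS 43 (1974), (1.5.4), Th. (1.6).
* Tree: `RootProductsResultant` (g45-#1), `WeilFactorizationOfPointCountFormula` (g45-#2),
  `AbelianVarietyPointCountIsogenyInvariance.pointCount_tensorObj`, `WeilConjecturesDeligneReductionProofs`
  (`IsWeilFactorization.unique`), `WeilFactorizationPointCountEstimate.pointCount_eq_sum_sum_roots`.

## Provenance

Lane `lit-hodgefound` (summit `HodgeConjecture`, Track 2 foundations library, Layer B: motives / zeta functions —
the zeta function of a product `Z(X × Y) = Z(X) ∗ Z(Y)`), seat `lit-hodgefound-p29` (literature-prover,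
generation 45, row g45-#3).
-/

universe u

open Polynomial CategoryTheory MonoidalCategory

noncomputable section

namespace Literature.NumberTheory.LFunctions

open Literature.Algebra.Polynomial (map_composedMulResultant_eq_prod coeff_zero_composedMul roots_map_composedMul
  natDegree_composedMul sum_roots_composedMul_inv_pow)

/-! ### §1 The composed multiplication on Weil data; roots and power sums of finite products -/

section ComposedMul

/-- The complex roots of `1 − cT` (`c ≠ 0`): the single root `c⁻¹`. [folklore] -/
private theorem roots_map_one_sub_C_mul_X {c : ℤ} (hc : c ≠ 0) :
    (((1 : ℤ[X]) - C c * X).map (Int.castRingHom ℂ)).roots = {((c : ℂ))⁻¹} := by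
  have hc' : (c : ℂ) ≠ 0 := by exact_mod_cast hc
  have h1 : ((1 : ℤ[X]) - C c * X).map (Int.castRingHom ℂ) = C (-(c : ℂ)) * (X - C ((c : ℂ)⁻¹)) := by
    rw [Polynomial.map_sub, Polynomial.map_one, Polynomial.map_mul, Polynomial.map_C, Polynomial.map_X,
      eq_intCast, mul_sub, ← C_mul, neg_mul, mul_inv_cancel₀ hc', C_neg, C_neg, C_1]
    ring
  rw [h1, roots_C_mul _ (neg_ne_zero.mpr hc'), roots_X_sub_C]

/-- **`(1 − aT) ⊙ (1 − bT) = 1 − abT`** (`a, b ≠ 0`): the composed multiplication of the end factors of Weil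
factorisations (`[a] ∗ [b] = [ab]` for the Teichmüller elements `[a] = (1 − at)⁻¹` of the Witt ring).
[cite: Ramachandran2014, §1 («gh([a][b]) = gh([a]) · gh([b])», «[q^n] … Z(X × 𝔸ⁿ, t) = Z(X,t) ∗ [qⁿ]»)] -/
theorem composedMul_one_sub_C_mul_X {a b : ℤ} (ha : a ≠ 0) (hb : b ≠ 0) :
    resultant (((1 : ℤ[X]) - C b * X).reverse.map C)
        ((((1 : ℤ[X]) - C a * X).map C).comp (C (X : ℤ[X]) * (X : ℤ[X][X])))
        ((1 : ℤ[X]) - C b * X).natDegree ((1 : ℤ[X]) - C a * X).natDegree =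
      1 - C (a * b) * X := by
  have hinj : Function.Injective (Int.castRingHom ℂ) := (Int.castRingHom ℂ).injective_int
  have ha0 : ((1 : ℤ[X]) - C a * X).coeff 0 = 1 := by simp
  have hb0 : ((1 : ℤ[X]) - C b * X).coeff 0 = 1 := by simp
  have hlead : (Int.castRingHom ℂ) ((1 : ℤ[X]) - C b * X).leadingCoeff ≠ 0 := by
    rw [Ne, map_eq_zero_iff _ hinj, leadingCoeff_eq_zero]
    intro h
    have h' := congrArg (fun p : ℤ[X] => p.coeff 0) h
    simp at h'
  apply Polynomial.map_injective (Int.castRingHom ℂ) hinj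
  rw [map_composedMulResultant_eq_prod _ _ (Int.castRingHom ℂ) ha0 hb0 hlead (IsAlgClosed.splits _)
    (IsAlgClosed.splits _), roots_map_one_sub_C_mul_X ha, roots_map_one_sub_C_mul_X hb]
  simp [Polynomial.map_sub, Polynomial.map_mul, inv_inv]

/-- **`(1 − T) ⊙ (1 − T) = 1 − T`** (`P₀(V) ⊙ P₀(W) = P₀(V × W)`; `[1] ∗ [1] = [1]`, the unit of `W(ℤ)` is
`Z(Spec 𝔽_q, t) = (1 − t)⁻¹`). [cite: Ramachandran2014, Remark 2.2 (i)] -/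
theorem composedMul_one_sub_X :
    resultant (((1 : ℤ[X]) - X).reverse.map C)
        ((((1 : ℤ[X]) - X).map C).comp (C (X : ℤ[X]) * (X : ℤ[X][X])))
        ((1 : ℤ[X]) - X).natDegree ((1 : ℤ[X]) - X).natDegree = 1 - X := by
  have e : ((1 : ℤ[X]) - X) = 1 - C 1 * X := by rw [C_1, one_mul]
  rw [e, composedMul_one_sub_C_mul_X one_ne_zero one_ne_zero, mul_one]

variable {F : Type*} [Field F]

/-- The roots of a finite product of non-zero polynomials, as a `Finset` sum of multisets. [folklore] -/
private theorem roots_finset_prod_eq_sum {ι : Type*} [DecidableEq ι] (s : Finset ι) (f : ι → F[X])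
    (h : ∀ i ∈ s, f i ≠ 0) : (∏ i ∈ s, f i).roots = ∑ i ∈ s, (f i).roots := by
  induction s using Finset.induction_on with
  | empty => rw [Finset.prod_empty, Finset.sum_empty, roots_one]; rfl
  | insert a s ha ih =>
    have hs : ∀ i ∈ s, f i ≠ 0 := fun i hi => h i (Finset.mem_insert_of_mem hi)
    rw [Finset.prod_insert ha, Finset.sum_insert ha,
      roots_mul (mul_ne_zero (h a (Finset.mem_insert_self a s)) (Finset.prod_ne_zero_iff.mpr hs)), ih hs]

/-- Power sums over the roots of a finite product are the sums of the power sums. [folklore] -/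
private theorem sum_roots_map_finset_prod {ι : Type*} [DecidableEq ι] (s : Finset ι) (f : ι → F[X])
    (h : ∀ i ∈ s, f i ≠ 0) (g : F → F) :
    ((∏ i ∈ s, f i).roots.map g).sum = ∑ i ∈ s, ((f i).roots.map g).sum := by
  rw [roots_finset_prod_eq_sum s f h]
  induction s using Finset.induction_on with
  | empty => rw [Finset.sum_empty, Finset.sum_empty, Multiset.map_zero, Multiset.sum_zero]
  | insert a s ha ih =>
    rw [Finset.sum_insert ha, Finset.sum_insert ha, Multiset.map_add, Multiset.sum_add,
      ih fun i hi => h i (Finset.mem_insert_of_mem hi)]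

/-- `Σ_κ [i + j = κ] f κ = f (i + j)` over `Fin N` when `i + j < N`. [folklore] -/
private theorem sum_ite_add_eq {M : Type*} [AddCommMonoid M] {N : ℕ} (a : ℕ) (ha : a < N) (f : Fin N → M) :
    ∑ κ : Fin N, (if a = (κ : ℕ) then f κ else 0) = f ⟨a, ha⟩ := by
  rw [Finset.sum_eq_single (⟨a, ha⟩ : Fin N)]
  · rw [if_pos rfl]
  · intro κ _ hκ
    exact if_neg fun h => hκ (Fin.ext h.symm)
  · exact fun h => absurd (Finset.mem_univ _) h

end ComposedMul

/-! ### §2 The Weil factorisation of `Z(V ×ₖ W, T)` -/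

section Products

open Literature.AlgebraicGeometry.Motives (SchemeOver IsWeilFactorization zetaSeries pointCount
  pointCount_tensorObj)

variable {k : Type u} [Field k] [Finite k]

/-- **The Weil conjectures pass to products (`Z(V × W, t) = Z(V, t) ∗ Z(W, t)` in `W(ℤ)`)**.  Let `V`, `W` be
schemes over the finite field `k` (`q = #k`) whose zeta functions have Weil factorisations `(PVᵢ)_{i ≤ 2n}`,
`(PWⱼ)_{j ≤ 2n'}` (`Pᵢ(0) = 1`, `Z ∏_{even} Pᵢ = ∏_{odd} Pᵢ`, `P₀ = 1 − T`, `P_{top} = 1 − q^{dim}T`, Riemann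
hypothesis).  Then `Z(V ×ₖ W, T)` has a Weil factorisation `(P_κ)_{κ ≤ 2(n+n')}` IN DIMENSION `n + n'` with
`deg P_κ = Σ_{i+j=κ} deg PVᵢ · deg PWⱼ` and complex roots of `P_κ` = the products `z w` of a root of `PVᵢ` and a
root of `PWⱼ`, `i + j = κ`, with multiplicity — namely `P_κ = ∏_{i+j=κ} PVᵢ ⊙ PWⱼ` (composed multiplication):
the rationality identity holds because both sides have the ghost components
`#(V ×ₖ W)(𝔽_{q^m}) = #V(𝔽_{q^m}) · #W(𝔽_{q^m}) = Σ_{i,j} (−1)^{i+j} Σ (αᵢβⱼ)^m`, the Riemann hypothesis because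
`|αᵢβⱼ| = q^{(i+j)/2}`.  No hypothesis on `V ×ₖ W` and no cohomology is used.
[cite: Ramachandran2014, Theorem 2.1 (i) and its two proofs] [cite: Hartshorne1977, II Thm. 3.3 and App. C (1.3)] -/
theorem _root_.Literature.AlgebraicGeometry.Motives.IsWeilFactorization.exists_tensor
    {n : ℕ} {V : SchemeOver k} {PV : Fin (2 * n + 1) → ℤ[X]}
    (hV : IsWeilFactorization (Nat.card k) n (zetaSeries V) PV)
    {n' : ℕ} {W : SchemeOver k} {PW : Fin (2 * n' + 1) → ℤ[X]}
    (hW : IsWeilFactorization (Nat.card k) n' (zetaSeries W) PW) :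
    ∃ PP : Fin (2 * (n + n') + 1) → ℤ[X],
      IsWeilFactorization (Nat.card k) (n + n') (zetaSeries (V ⊗ W)) PP ∧
      (∀ κ, (PP κ).natDegree = ∑ i : Fin (2 * n + 1), ∑ j : Fin (2 * n' + 1),
        if (i : ℕ) + (j : ℕ) = (κ : ℕ) then (PV i).natDegree * (PW j).natDegree else 0) ∧
      ∀ κ, ((PP κ).map (Int.castRingHom ℂ)).roots = ∑ i : Fin (2 * n + 1), ∑ j : Fin (2 * n' + 1),
        if (i : ℕ) + (j : ℕ) = (κ : ℕ) then
          (((PV i).map (Int.castRingHom ℂ)).roots ×ˢ ((PW j).map (Int.castRingHom ℂ)).roots).map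
            fun zw => zw.1 * zw.2
        else 0 := by
  classical
  set φ := Int.castRingHom ℂ with hφ_def
  have hinj : Function.Injective φ := (Int.castRingHom ℂ).injective_int
  have hq0 : (Nat.card k : ℤ) ≠ 0 := by exact_mod_cast Nat.card_pos.ne'
  have hqR : (0 : ℝ) < Nat.card k := by exact_mod_cast Nat.card_pos
  -- the composed multiplications `M i j = PVᵢ ⊙ PWⱼ`
  set M : Fin (2 * n + 1) → Fin (2 * n' + 1) → ℤ[X] := fun i j =>
    resultant ((PW j).reverse.map C) (((PV i).map C).comp (C (X : ℤ[X]) * (X : ℤ[X][X])))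
      (PW j).natDegree (PV i).natDegree with hM_def
  have hM0 : ∀ i j, (M i j).coeff 0 = 1 := fun i j =>
    coeff_zero_composedMul hinj (IsAlgClosed.splits _) (IsAlgClosed.splits _) (hV.1 i) (hW.1 j)
  have hMne : ∀ i j, M i j ≠ 0 := fun i j h => by
    have h1 := hM0 i j
    rw [h, coeff_zero] at h1
    exact zero_ne_one h1
  have hMne' : ∀ i j, (M i j).map φ ≠ 0 := fun i j h => by
    have h1 : ((M i j).map φ).coeff 0 = 1 := by rw [coeff_map, hM0 i j, map_one]
    rw [h, coeff_zero] at h1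
    exact zero_ne_one h1
  have hMroots : ∀ i j, ((M i j).map φ).roots =
      (((PV i).map φ).roots ×ˢ ((PW j).map φ).roots).map fun zw => zw.1 * zw.2 := fun i j =>
    roots_map_composedMul hinj (IsAlgClosed.splits _) (IsAlgClosed.splits _) (hV.1 i) (hW.1 j)
  have hMdeg : ∀ i j, (M i j).natDegree = (PV i).natDegree * (PW j).natDegree := fun i j =>
    natDegree_composedMul hinj (IsAlgClosed.splits _) (IsAlgClosed.splits _) (hV.1 i) (hW.1 j)
  have hMsum : ∀ i j (r : ℕ), (((M i j).map φ).roots.map fun u => u⁻¹ ^ r).sum =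
      (((PV i).map φ).roots.map fun z => z⁻¹ ^ r).sum * (((PW j).map φ).roots.map fun w => w⁻¹ ^ r).sum :=
    fun i j r => sum_roots_composedMul_inv_pow hinj (IsAlgClosed.splits _) (IsAlgClosed.splits _) (hV.1 i) (hW.1 j) r
  -- `P_κ = ∏_{i + j = κ} M i j`
  set PP : Fin (2 * (n + n') + 1) → ℤ[X] := fun κ =>
    ∏ i : Fin (2 * n + 1), ∏ j : Fin (2 * n' + 1), if (i : ℕ) + (j : ℕ) = (κ : ℕ) then M i j else 1
    with hPP_def
  have hF0 : ∀ (κ : Fin (2 * (n + n') + 1)) (i : Fin (2 * n + 1)) (j : Fin (2 * n' + 1)),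
      ((if (i : ℕ) + (j : ℕ) = (κ : ℕ) then M i j else 1) : ℤ[X]).coeff 0 = 1 := by
    intro κ i j
    split_ifs
    · exact hM0 i j
    · exact coeff_one_zero
  have hFne : ∀ (κ : Fin (2 * (n + n') + 1)) (i : Fin (2 * n + 1)) (j : Fin (2 * n' + 1)),
      ((if (i : ℕ) + (j : ℕ) = (κ : ℕ) then M i j else 1) : ℤ[X]) ≠ 0 := by
    intro κ i j
    split_ifs
    · exact hMne i j
    · exact one_ne_zero
  have hFne' : ∀ (κ : Fin (2 * (n + n') + 1)) (i : Fin (2 * n + 1)) (j : Fin (2 * n' + 1)),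
      (((if (i : ℕ) + (j : ℕ) = (κ : ℕ) then M i j else 1) : ℤ[X]).map φ) ≠ 0 := by
    intro κ i j
    split_ifs
    · exact hMne' i j
    · rw [Polynomial.map_one]; exact one_ne_zero
  have hPP0 : ∀ κ, (PP κ).coeff 0 = 1 := by
    intro κ
    rw [hPP_def]
    dsimp only
    rw [coeff_zero_prod]
    refine Finset.prod_eq_one fun i _ => ?_
    rw [coeff_zero_prod]
    exact Finset.prod_eq_one fun j _ => hF0 κ i j
  -- roots of `P_κ` over `ℂ`
  have hPProots : ∀ κ, ((PP κ).map φ).roots = ∑ i : Fin (2 * n + 1), ∑ j : Fin (2 * n' + 1),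
      if (i : ℕ) + (j : ℕ) = (κ : ℕ) then
        (((PV i).map φ).roots ×ˢ ((PW j).map φ).roots).map fun zw => zw.1 * zw.2 else 0 := by
    intro κ
    rw [hPP_def]
    dsimp only
    rw [Polynomial.map_prod, roots_finset_prod_eq_sum _ _ fun i _ => ?_]
    · refine Finset.sum_congr rfl fun i _ => ?_
      rw [Polynomial.map_prod, roots_finset_prod_eq_sum _ _ fun j _ => hFne' κ i j]
      refine Finset.sum_congr rfl fun j _ => ?_
      split_ifs with h
      · exact hMroots i j
      · rw [Polynomial.map_one, roots_one]
        rfl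
    · rw [Polynomial.map_prod]
      exact Finset.prod_ne_zero_iff.mpr fun j _ => hFne' κ i j
  refine ⟨PP, isWeilFactorization_of_pointCount_eq hPP0 ?_ ?_ ?_ ?_, ?_, hPProots⟩
  · -- `P₀ = PV₀ ⊙ PW₀ = (1 − T) ⊙ (1 − T) = 1 − T`
    rw [hPP_def]
    dsimp only
    rw [Finset.prod_eq_single (0 : Fin (2 * n + 1)), Finset.prod_eq_single (0 : Fin (2 * n' + 1)),
      if_pos (by simp), hM_def]
    · dsimp only
      rw [hV.2.2.1, hW.2.2.1]
      exact composedMul_one_sub_X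
    · intro j _ hj
      refine if_neg fun h => hj (Fin.ext ?_)
      simp only [Fin.val_zero, zero_add] at h
      simpa using h
    · exact fun h => absurd (Finset.mem_univ _) h
    · intro i _ hi
      refine Finset.prod_eq_one fun j _ => if_neg fun h => hi (Fin.ext ?_)
      simp only [Fin.val_zero] at h
      simp only [Fin.val_zero]
      omega
    · exact fun h => absurd (Finset.mem_univ _) h
  · -- `P_{2(n+n')} = PV_{2n} ⊙ PW_{2n'} = (1 − qⁿT) ⊙ (1 − q^{n'}T) = 1 − q^{n+n'}T`
    rw [hPP_def]
    dsimp only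
    rw [Finset.prod_eq_single (Fin.last (2 * n)), Finset.prod_eq_single (Fin.last (2 * n')),
      if_pos (by simp only [Fin.val_last]; ring), hM_def]
    · dsimp only
      rw [hV.2.2.2.1, hW.2.2.2.1, composedMul_one_sub_C_mul_X (pow_ne_zero _ hq0) (pow_ne_zero _ hq0), ← pow_add]
    · intro j _ hj
      refine if_neg fun h => hj (Fin.ext ?_)
      simp only [Fin.val_last] at h ⊢
      have := j.isLt
      omega
    · exact fun h => absurd (Finset.mem_univ _) h
    · intro i _ hi
      refine Finset.prod_eq_one fun j _ => if_neg fun h => hi (Fin.ext ?_)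
      simp only [Fin.val_last] at h ⊢
      have := i.isLt
      have := j.isLt
      omega
    · exact fun h => absurd (Finset.mem_univ _) h
  · -- the Riemann hypothesis: `|zw| = q^{−(i+j)/2}`
    intro κ u hu
    have hne : (PP κ).map φ ≠ 0 := fun h => by
      have h1 : ((PP κ).map φ).coeff 0 = 1 := by rw [coeff_map, hPP0 κ, map_one]
      rw [h, coeff_zero] at h1
      exact zero_ne_one h1
    have hmem : u ∈ ((PP κ).map φ).roots := (mem_roots hne).mpr hu
    rw [hPProots κ, Multiset.mem_sum] at hmem
    obtain ⟨i, -, hmem⟩ := hmem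
    rw [Multiset.mem_sum] at hmem
    obtain ⟨j, -, hmem⟩ := hmem
    by_cases hij : (i : ℕ) + (j : ℕ) = (κ : ℕ)
    · rw [if_pos hij, Multiset.mem_map] at hmem
      obtain ⟨zw, hzw, rfl⟩ := hmem
      obtain ⟨hz, hw⟩ := Multiset.mem_product.mp hzw
      have hVne : (PV i).map φ ≠ 0 := fun h => by
        have h1 : ((PV i).map φ).coeff 0 = 1 := by rw [coeff_map, hV.1 i, map_one]
        rw [h, coeff_zero] at h1
        exact zero_ne_one h1
      have hWne : (PW j).map φ ≠ 0 := fun h => by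
        have h1 : ((PW j).map φ).coeff 0 = 1 := by rw [coeff_map, hW.1 j, map_one]
        rw [h, coeff_zero] at h1
        exact zero_ne_one h1
      rw [norm_mul, hV.2.2.2.2 i zw.1 ((mem_roots hVne).mp hz), hW.2.2.2.2 j zw.2 ((mem_roots hWne).mp hw),
        ← Real.rpow_add hqR, ← hij, Nat.cast_add]
      congr 1
      ring
    · rw [if_neg hij] at hmem
      exact absurd hmem (Multiset.notMem_zero u)
  · -- the ghost components: `#(V × W)(𝔽_{q^m}) = #V · #W = Σ_{i,j} (−1)^{i+j} Σ (αᵢβⱼ)^m = Σ_κ (−1)^κ Σ_{P_κ}`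
    intro m
    have hsumPP : ∀ κ : Fin (2 * (n + n') + 1), (((PP κ).map φ).roots.map fun u => u⁻¹ ^ (m + 1)).sum =
        ∑ i : Fin (2 * n + 1), ∑ j : Fin (2 * n' + 1),
          if (i : ℕ) + (j : ℕ) = (κ : ℕ) then (((M i j).map φ).roots.map fun u => u⁻¹ ^ (m + 1)).sum else 0 := by
      intro κ
      rw [hPP_def]
      dsimp only
      rw [Polynomial.map_prod, sum_roots_map_finset_prod _ _ fun i _ => ?_]
      · refine Finset.sum_congr rfl fun i _ => ?_
        rw [Polynomial.map_prod, sum_roots_map_finset_prod _ _ fun j _ => hFne' κ i j]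
        refine Finset.sum_congr rfl fun j _ => ?_
        split_ifs with h
        · rfl
        · rw [Polynomial.map_one, roots_one, Multiset.empty_eq_zero, Multiset.map_zero, Multiset.sum_zero]
      · rw [Polynomial.map_prod]
        exact Finset.prod_ne_zero_iff.mpr fun j _ => hFne' κ i j
    have hite : ∀ (i : Fin (2 * n + 1)) (j : Fin (2 * n' + 1)) (κ : Fin (2 * (n + n') + 1)),
        (-1 : ℂ) ^ (κ : ℕ) * (if (i : ℕ) + (j : ℕ) = (κ : ℕ) then
          (((M i j).map φ).roots.map fun u => u⁻¹ ^ (m + 1)).sum else 0) =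
        if (i : ℕ) + (j : ℕ) = (κ : ℕ) then
          (-1 : ℂ) ^ ((i : ℕ) + (j : ℕ)) * (((M i j).map φ).roots.map fun u => u⁻¹ ^ (m + 1)).sum else 0 := by
      intro i j κ
      split_ifs with h
      · rw [h]
      · rw [mul_zero]
    have hR : ∑ κ : Fin (2 * (n + n') + 1), (-1 : ℂ) ^ (κ : ℕ) *
        (((PP κ).map (Int.castRingHom ℂ)).roots.map fun z => z⁻¹ ^ (m + 1)).sum =
        ∑ κ : Fin (2 * (n + n') + 1), ∑ i : Fin (2 * n + 1), ∑ j : Fin (2 * n' + 1),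
          if (i : ℕ) + (j : ℕ) = (κ : ℕ) then
            (-1 : ℂ) ^ ((i : ℕ) + (j : ℕ)) * (((M i j).map φ).roots.map fun u => u⁻¹ ^ (m + 1)).sum else 0 := by
      refine Finset.sum_congr rfl fun κ _ => ?_
      rw [← hφ_def, hsumPP κ, Finset.mul_sum]
      refine Finset.sum_congr rfl fun i _ => ?_
      rw [Finset.mul_sum]
      exact Finset.sum_congr rfl fun j _ => hite i j κ
    have hR' : ∑ κ : Fin (2 * (n + n') + 1), ∑ i : Fin (2 * n + 1), ∑ j : Fin (2 * n' + 1),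
          (if (i : ℕ) + (j : ℕ) = (κ : ℕ) then
            (-1 : ℂ) ^ ((i : ℕ) + (j : ℕ)) * (((M i j).map φ).roots.map fun u => u⁻¹ ^ (m + 1)).sum else 0) =
        ∑ i : Fin (2 * n + 1), ∑ j : Fin (2 * n' + 1), ∑ κ : Fin (2 * (n + n') + 1),
          (if (i : ℕ) + (j : ℕ) = (κ : ℕ) then
            (-1 : ℂ) ^ ((i : ℕ) + (j : ℕ)) * (((M i j).map φ).roots.map fun u => u⁻¹ ^ (m + 1)).sum else 0) := by
      rw [Finset.sum_comm]
      exact Finset.sum_congr rfl fun i _ => Finset.sum_comm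
    rw [pointCount_tensorObj, Nat.cast_mul, pointCount_eq_sum_sum_roots hV m, pointCount_eq_sum_sum_roots hW m,
      Finset.sum_mul_sum, hR, hR']
    refine Finset.sum_congr rfl fun i _ => Finset.sum_congr rfl fun j _ => ?_
    have hlt : (i : ℕ) + (j : ℕ) < 2 * (n + n') + 1 := by
      have := i.isLt
      have := j.isLt
      omega
    rw [sum_ite_add_eq _ hlt, ← hφ_def, hMsum i j (m + 1), pow_add]
    ring
  · -- degrees
    intro κ
    rw [hPP_def]
    dsimp only
    rw [natDegree_prod _ _ fun i _ => Finset.prod_ne_zero_iff.mpr fun j _ => hFne κ i j]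
    refine Finset.sum_congr rfl fun i _ => ?_
    rw [natDegree_prod _ _ fun j _ => hFne κ i j]
    refine Finset.sum_congr rfl fun j _ => ?_
    split_ifs with h
    · exact hMdeg i j
    · exact natDegree_one

/-- **Any Weil factorisation of `Z(V ×ₖ W, T)` in dimension `dim V + dim W` is the product one**: its
`κ`-th polynomial has degree `Σ_{i+j=κ} deg PVᵢ · deg PWⱼ` and complex roots the products `z w` (`z` a root of
`PVᵢ`, `w` of `PWⱼ`, `i + j = κ`) with multiplicity — by uniqueness of Weil factorisations (Deligne: the `Pᵢ`
are determined by `Z`; tree `IsWeilFactorization.unique`) and `exists_tensor`.  «By the Künneth theorem, any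
`α_{X×Y}` is a product of a `α_X` and a `α_Y`» — here without Künneth.
[cite: Ramachandran2014, Theorem 2.1 (i) (second proof)] [cite: Deligne1974, Th. (1.6) and p. 277] -/
theorem _root_.Literature.AlgebraicGeometry.Motives.IsWeilFactorization.tensor_roots_eq_sum
    {n : ℕ} {V : SchemeOver k} {PV : Fin (2 * n + 1) → ℤ[X]}
    (hV : IsWeilFactorization (Nat.card k) n (zetaSeries V) PV)
    {n' : ℕ} {W : SchemeOver k} {PW : Fin (2 * n' + 1) → ℤ[X]}
    (hW : IsWeilFactorization (Nat.card k) n' (zetaSeries W) PW)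
    {PP : Fin (2 * (n + n') + 1) → ℤ[X]} (hP : IsWeilFactorization (Nat.card k) (n + n') (zetaSeries (V ⊗ W)) PP)
    (κ : Fin (2 * (n + n') + 1)) :
    (PP κ).natDegree = (∑ i : Fin (2 * n + 1), ∑ j : Fin (2 * n' + 1),
        if (i : ℕ) + (j : ℕ) = (κ : ℕ) then (PV i).natDegree * (PW j).natDegree else 0) ∧
      ((PP κ).map (Int.castRingHom ℂ)).roots = ∑ i : Fin (2 * n + 1), ∑ j : Fin (2 * n' + 1),
        if (i : ℕ) + (j : ℕ) = (κ : ℕ) then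
          (((PV i).map (Int.castRingHom ℂ)).roots ×ˢ ((PW j).map (Int.castRingHom ℂ)).roots).map
            fun zw => zw.1 * zw.2
        else 0 := by
  obtain ⟨PP', hP', hdeg, hroots⟩ := hV.exists_tensor hW
  have h := Literature.AlgebraicGeometry.Motives.IsWeilFactorization.unique Finite.one_lt_card hP hP'
  subst h
  exact ⟨hdeg κ, hroots κ⟩

/-- **The Weil conjectures for `X ×ₖ Y` from the Weil conjectures for `X` and `Y`**: if `Z(X, T)` admits a Weil
factorisation in dimension `n` and `Z(Y, T)` one in dimension `n'`, then `Z(X ×ₖ Y, T)` admits one in dimension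
`n + n'` (the shape of the tree's named statement `exists_isWeilFactorization`, for the product) —
`Z(X × Y, t) = Z(X, t) ∗ Z(Y, t)`. [cite: Ramachandran2014, Theorem 2.1 (i)] [cite: Hartshorne1977, App. C Th. 1.1–1.3] -/
theorem exists_isWeilFactorization_tensor {n n' : ℕ} {V W : SchemeOver k}
    (hV : ∃ PV : Fin (2 * n + 1) → ℤ[X], IsWeilFactorization (Nat.card k) n (zetaSeries V) PV)
    (hW : ∃ PW : Fin (2 * n' + 1) → ℤ[X], IsWeilFactorization (Nat.card k) n' (zetaSeries W) PW) :
    ∃ PP : Fin (2 * (n + n') + 1) → ℤ[X], IsWeilFactorization (Nat.card k) (n + n') (zetaSeries (V ⊗ W)) PP := by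
  obtain ⟨PV, hV⟩ := hV
  obtain ⟨PW, hW⟩ := hW
  obtain ⟨PP, hP, -, -⟩ := hV.exists_tensor hW
  exact ⟨PP, hP⟩

end Products

end Literature.NumberTheory.LFunctions
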